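import Summits.CriticalPhenomena.PercolationContinuityZ3.Theorems.PercNearOneGluingNoHeavyQuantAD3ProdCellCexCuts
import Summits.CriticalPhenomena.PercolationContinuityZ3.Theorems.PercNearOneGluingNoHeavyQuantConvHeavy
import HarnessLib

/-!
# QUANT lane R8, Route 2 — `LawDec.AD3ProdCell` IS FALSE: the product of an admissible residue triple and a threshold-heavy pair need not be AD3⁺

builds on p205010 (kernel theorem, internal audit signed; external expert review pending)

Support file (`--supports stmt-CriticalPhenomena-4575`), QUANT lane seat prim-quant-arm-2 (gen 37), rung R8 of
`run/shared/lean/prim/quant/LADDER.md`.  Memo `run/shared/lean/prim/quant/prim-quant-arm-2-g37/CEX-AD3PRODCELL-G37.md`.  Theorems only, standard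
axioms, no sorries.  Part 1 (the weak-duality cuts of the frame) is `…QuantAD3ProdCellCexCuts`.

THE WITNESS.  `y = 99/125`, `q = 99/100`; `ω₁ = TR[1,2,4; 1/10,1/5,7/10]` at `M₁ = 4`, `T₁ = 33/10` — a residue triple (`s₂ = 2 ≤ T₁`,
`q(T₁ − 2) = 1.287 < y·(4 − 2) = 1.584`), top-affordable (`3.168 ≤ 3.267`), admissible (`AD3ProdCellCex.omega1_dec`); `ω₂ = TP[0,8; 4/5]` at
`M₂ = 8`, `T₂ = 32/5` — a heavy pair at threshold (`qγ = y`), top-affordable with equality.  The product law is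
`P = {1: 1/50, 2: 1/25, 4: 7/50, 9: 2/25, 10: 4/25, 12: 14/25}` (`M = 12`, `T = 97/10`).  Suppose `P = Σ v_k ω_k` were an AD3⁺ decomposition.
Every genuine component is a nonnegative law supported inside `S = {1,2,4,9,10,12}` with mean `97/10`; the functional
`Φ μ = (10913/331279)μ1 + (5/17)μ2 + μ4 − μ9 − (11/17)μ10 + (1/17)μ12` satisfies `Φ ≤ 0` on every such component (`AD3ProdCellCex.phi_component_nonpos`:
heavy and light pairs by the mean, the light top pairs `{k,12}` and the triples `{a, b ≤ 4, 12}` are not admissible, the triples `{a, 9|10, 12}` by the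
cuts P2/P3 of part 1, the triples with top `10` and `{9,10,12}` by the mean), yet `Φ P = 608/331279 > 0` — contradiction.  MECHANISM: the product's
top atom `s₃ + M₂ = 12 = M` carries `p₃γ = 0.56`, and its only admissible carriers need more middle mass (`9`, `10`) per unit of low mass than the
product has.  The product itself IS DEC at every layer (memo §2): an admissible six-atom law outside the convex hull of the admissible
≤ 3-atom laws — so no repair inside "mixtures of admissible pairs/triples" exists (memo §4; failing family: the extreme pair `{0, M₂; γ}` with
`y/q ≤ γ ≤ y/q + 10⁻⁴` and tight top-affordability).

* `AD3ProdCellCex.not_ad3Decomp_witness` — the product of the two witness components is not `AD3Decomp` (the shape every product cell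
  concludes; lead g35's `AD3ProdCellTriple` is refuted by the same one-line application once `…QuantAD3ProdCellSplit` lands).
* **`LawDec.not_ad3ProdCell : ¬ AD3ProdCell`** — the Route-2 product cell of `…QuantTreeBuiltAD3Cells` is false.
  (`AD3GateCell` and the pair ⊗ pair cell `AD3FrechetCell` are unaffected.)

[this work].  Nothing here is cited as a published result.  The gluing rows served [cite: KozmaNitzan2024, Conjecture 3 (p. 15)]; product measure
[cite: Grimmett1999, §1.3 p. 10].
-/

noncomputable section

namespace Summit.CriticalPhenomena.PercolationContinuityZ3.Theorems

namespace Quant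

open Finset

/-- two-point law notation `TP[lo, hi, g, h] = g·[h = hi] + (1 − g)·[h = lo]` (as in the lane's other files). -/
local notation3 "TP[" lo ", " hi ", " g ", " h "]" =>
  (g : ℝ) * (if (h : ℕ) = (hi : ℕ) then (1 : ℝ) else 0) + (1 - (g : ℝ)) * (if (h : ℕ) = (lo : ℕ) then (1 : ℝ) else 0)

/-- three-atom law notation `TR[s₁, s₂, s₃, p₁, p₂, p₃, h] = p₁·[h = s₁] + p₂·[h = s₂] + p₃·[h = s₃]`. -/
local notation3 "TR[" s₁ ", " s₂ ", " s₃ ", " p₁ ", " p₂ ", " p₃ ", " h "]" =>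
  (p₁ : ℝ) * (if (h : ℕ) = (s₁ : ℕ) then (1 : ℝ) else 0) + (p₂ : ℝ) * (if (h : ℕ) = (s₂ : ℕ) then (1 : ℝ) else 0)
    + (p₃ : ℝ) * (if (h : ℕ) = (s₃ : ℕ) then (1 : ℝ) else 0)

namespace LawDec

/-- the Farkas coefficient of the atom `h` (`S = {1,2,4,9,10,12}` ↦ `10913/331279, 5/17, 1, −1, −11/17, 1/17`, else `0`), written with
indicators `[(k : ℕ) = h]`. -/
local notation3 "CF[" h "]" =>
  ((10913/331279 : ℝ) * (if (1 : ℕ) = (h : ℕ) then (1 : ℝ) else 0) + 5/17 * (if (2 : ℕ) = (h : ℕ) then (1 : ℝ) else 0)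
    + (if (4 : ℕ) = (h : ℕ) then (1 : ℝ) else 0) - (if (9 : ℕ) = (h : ℕ) then (1 : ℝ) else 0)
    - 11/17 * (if (10 : ℕ) = (h : ℕ) then (1 : ℝ) else 0) + 1/17 * (if (12 : ℕ) = (h : ℕ) then (1 : ℝ) else 0))

/-- the Farkas functional `Φ μ = Σ_{h ∈ S} cf h · μ h`. -/
local notation3 "PHI[" μ "]" =>
  ((10913/331279 : ℝ) * (μ : ℕ → ℝ) 1 + 5/17 * (μ : ℕ → ℝ) 2 + (μ : ℕ → ℝ) 4 - (μ : ℕ → ℝ) 9 - 11/17 * (μ : ℕ → ℝ) 10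
    + 1/17 * (μ : ℕ → ℝ) 12)

/-- the product law `P = lconv 4 8 ω₁ ω₂ = {1: 1/50, 2: 1/25, 4: 7/50, 9: 2/25, 10: 4/25, 12: 14/25}`. -/
local notation3 "PW" =>
  (fun h : ℕ => if h = 1 then (1/50 : ℝ) else if h = 2 then 1/25 else if h = 4 then 7/50 else if h = 9 then 2/25
    else if h = 10 then 4/25 else if h = 12 then 14/25 else 0)

namespace AD3ProdCellCex

/-! ### The functional -/

/-- `Φ` of a two-point law. [this work] -/
theorem phi_TP (lo hi : ℕ) (γ : ℝ) : PHI[fun h => TP[lo, hi, γ, h]] = γ * CF[hi] + (1 - γ) * CF[lo] := by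
  dsimp only
  ring

/-- `Φ` of a three-atom law. [this work] -/
theorem phi_TR (s₁ s₂ s₃ : ℕ) (p₁ p₂ p₃ : ℝ) :
    PHI[fun h => TR[s₁, s₂, s₃, p₁, p₂, p₃, h]] = p₁ * CF[s₁] + p₂ * CF[s₂] + p₃ * CF[s₃] := by
  dsimp only
  ring

/-- a natural number is not `97/10`. [this work] -/
theorem nat_ne_mean (n : ℕ) (h : (n : ℝ) = 97/10) : False := by
  have h1 : (10 * n : ℕ) = 97 := by
    have : (10 : ℝ) * n = 97 := by rw [h]; norm_num
    exact_mod_cast this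
  omega

/-! ### `Φ ≤ 0` on every component supported in `S` -/

/-- **pairs**: a two-point law of mean `97/10` supported in `S`, heavy or light-admissible at `M = 12`, has `Φ ≤ 0`. [this work] -/
theorem phi_pair_nonpos (lo hi : ℕ) (γ : ℝ) (hlohi : lo ≤ hi) (hγ0 : 0 ≤ γ) (hγ1 : γ ≤ 1)
    (hmean : (lo : ℝ) + ((hi : ℝ) - lo) * γ = 97/10)
    (hkind : 99/125 ≤ 99/100 * γ ∨
      (99/100 * γ < 99/125 ∧ ∀ j', j' < 12 → DECAt (99/125) j' 12 (gate (fun h => TP[lo, hi, γ, h]) (99/100))))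
    (hS : ∀ h, h ≠ 1 → h ≠ 2 → h ≠ 4 → h ≠ 9 → h ≠ 10 → h ≠ 12 → TP[lo, hi, γ, h] = 0) :
    PHI[fun h => TP[lo, hi, γ, h]] ≤ 0 := by
  have mem : ∀ h, TP[lo, hi, γ, h] ≠ 0 → h = 1 ∨ h = 2 ∨ h = 4 ∨ h = 9 ∨ h = 10 ∨ h = 12 := by
    intro h hne
    by_contra hn
    push Not at hn
    exact hne (hS h hn.1 hn.2.1 hn.2.2.1 hn.2.2.2.1 hn.2.2.2.2.1 hn.2.2.2.2.2)
  -- degenerate gates put a point mass at an integer of mean 97/10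
  rcases hγ0.eq_or_lt with hγz | hγpos
  · subst hγz
    exact (nat_ne_mean lo (by linarith)).elim
  rcases hγ1.eq_or_lt with hγone | hγlt1
  · subst hγone
    exact (nat_ne_mean hi (by linarith)).elim
  have hlo : lo = 1 ∨ lo = 2 ∨ lo = 4 ∨ lo = 9 ∨ lo = 10 ∨ lo = 12 := by
    refine mem lo ?_
    rw [if_pos (rfl : lo = lo)]
    intro h0
    split_ifs at h0 <;> linarith
  have hhi : hi = 1 ∨ hi = 2 ∨ hi = 4 ∨ hi = 9 ∨ hi = 10 ∨ hi = 12 := by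
    refine mem hi ?_
    rw [if_pos (rfl : hi = hi)]
    intro h0
    split_ifs at h0 <;> linarith
  rw [phi_TP]
  rcases hkind with hk | ⟨hk, hdec⟩
  · rcases hlo with rfl | rfl | rfl | rfl | rfl | rfl <;> rcases hhi with rfl | rfl | rfl | rfl | rfl | rfl
    all_goals first
      | (exfalso; norm_num at hlohi; done)
      | (exfalso; norm_num at hmean; done)
      | (norm_num at hmean ⊢; linarith)
  · rcases hlo with rfl | rfl | rfl | rfl | rfl | rfl <;> rcases hhi with rfl | rfl | rfl | rfl | rfl | rfl
    all_goals first
      | (exfalso; norm_num at hlohi; done)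
      | (exfalso; norm_num at hmean; done)
      | (norm_num at hmean ⊢; linarith)
      | exact (lightTop_absurd 1 (Or.inl rfl) γ (by push_cast at hmean ⊢; linarith) (hdec 11 (by norm_num))).elim
      | exact (lightTop_absurd 2 (Or.inr (Or.inl rfl)) γ (by push_cast at hmean ⊢; linarith) (hdec 11 (by norm_num))).elim
      | exact (lightTop_absurd 4 (Or.inr (Or.inr rfl)) γ (by push_cast at hmean ⊢; linarith) (hdec 11 (by norm_num))).elim

/-- **triples**: a residue triple of mean `97/10` supported in `S`, admissible at `M = 12`, has `Φ ≤ 0`. [this work] -/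
theorem phi_triple_nonpos (s₁ s₂ s₃ : ℕ) (p₁ p₂ p₃ : ℝ) (h12 : s₁ < s₂) (h23 : s₂ < s₃)
    (hp₁ : 0 < p₁) (hp₂ : 0 < p₂) (hp₃ : 0 < p₃) (hsum : p₁ + p₂ + p₃ = 1)
    (hmean : p₁ * (s₁ : ℝ) + p₂ * (s₂ : ℝ) + p₃ * (s₃ : ℝ) = 97/10)
    (hdec : ∀ j', j' < 12 → DECAt (99/125) j' 12 (gate (fun h => TR[s₁, s₂, s₃, p₁, p₂, p₃, h]) (99/100)))
    (hS : ∀ h, h ≠ 1 → h ≠ 2 → h ≠ 4 → h ≠ 9 → h ≠ 10 → h ≠ 12 → TR[s₁, s₂, s₃, p₁, p₂, p₃, h] = 0) :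
    PHI[fun h => TR[s₁, s₂, s₃, p₁, p₂, p₃, h]] ≤ 0 := by
  have mem : ∀ h, TR[s₁, s₂, s₃, p₁, p₂, p₃, h] ≠ 0 → h = 1 ∨ h = 2 ∨ h = 4 ∨ h = 9 ∨ h = 10 ∨ h = 12 := by
    intro h hne
    by_contra hn
    push Not at hn
    exact hne (hS h hn.1 hn.2.1 hn.2.2.1 hn.2.2.2.1 hn.2.2.2.2.1 hn.2.2.2.2.2)
  have hs1 : s₁ = 1 ∨ s₁ = 2 ∨ s₁ = 4 ∨ s₁ = 9 ∨ s₁ = 10 ∨ s₁ = 12 := by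
    refine mem s₁ ?_
    rw [if_pos (rfl : s₁ = s₁), if_neg (show s₁ ≠ s₂ by omega), if_neg (show s₁ ≠ s₃ by omega)]
    intro h0; linarith
  have hs2 : s₂ = 1 ∨ s₂ = 2 ∨ s₂ = 4 ∨ s₂ = 9 ∨ s₂ = 10 ∨ s₂ = 12 := by
    refine mem s₂ ?_
    rw [if_neg (show s₂ ≠ s₁ by omega), if_pos (rfl : s₂ = s₂), if_neg (show s₂ ≠ s₃ by omega)]
    intro h0; linarith
  have hs3 : s₃ = 1 ∨ s₃ = 2 ∨ s₃ = 4 ∨ s₃ = 9 ∨ s₃ = 10 ∨ s₃ = 12 := by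
    refine mem s₃ ?_
    rw [if_neg (show s₃ ≠ s₁ by omega), if_neg (show s₃ ≠ s₂ by omega), if_pos (rfl : s₃ = s₃)]
    intro h0; linarith
  rw [phi_TR]
  rcases hs1 with rfl | rfl | rfl | rfl | rfl | rfl <;> rcases hs2 with rfl | rfl | rfl | rfl | rfl | rfl <;>
    rcases hs3 with rfl | rfl | rfl | rfl | rfl | rfl
  -- the 20 ordered triples of S survive `omega`; those below the mean, with top 10, or {9,10,12} close by the mean alone
  all_goals first
    | (exfalso; omega)
    | (push_cast at hmean; norm_num; linarith)
    | skip
  -- {1,2,12}, {1,4,12}: never admissible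
  · exact (triple_lowTop_absurd 1 2 (Or.inl ⟨rfl, rfl⟩) p₁ p₂ p₃ hp₂.le hsum (by push_cast at hmean ⊢; linarith)
      (hdec 11 (by norm_num))).elim
  · exact (triple_lowTop_absurd 1 4 (Or.inr (Or.inl ⟨rfl, rfl⟩)) p₁ p₂ p₃ hp₂.le hsum (by push_cast at hmean ⊢; linarith)
      (hdec 11 (by norm_num))).elim
  -- {1,9,12}, {1,10,12}: P3
  · have hc := triple_P3_cut_1_9 p₁ p₂ p₃ (by push_cast at hmean ⊢; linarith) (hdec 11 (by norm_num))
    push_cast at hmean; norm_num; linarith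
  · have hc := triple_P3_cut_1_10 p₁ p₂ p₃ (by push_cast at hmean ⊢; linarith) (hdec 11 (by norm_num))
    push_cast at hmean; norm_num; linarith
  -- {2,4,12}: never admissible
  · exact (triple_lowTop_absurd 2 4 (Or.inr (Or.inr ⟨rfl, rfl⟩)) p₁ p₂ p₃ hp₂.le hsum (by push_cast at hmean ⊢; linarith)
      (hdec 11 (by norm_num))).elim
  -- {2,9,12}, {2,10,12}, {4,9,12}, {4,10,12}: P2
  · have hc := triple_P2_cut 2 9 (Or.inl ⟨rfl, rfl⟩) p₁ p₂ p₃ (by push_cast at hmean ⊢; linarith) (hdec 5 (by norm_num))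
    push_cast at hmean; norm_num; linarith
  · have hc := triple_P2_cut 2 10 (Or.inr (Or.inl ⟨rfl, rfl⟩)) p₁ p₂ p₃ (by push_cast at hmean ⊢; linarith) (hdec 5 (by norm_num))
    push_cast at hmean; norm_num; linarith
  · have hc := triple_P2_cut 4 9 (Or.inr (Or.inr (Or.inl ⟨rfl, rfl⟩))) p₁ p₂ p₃ (by push_cast at hmean ⊢; linarith)
      (hdec 5 (by norm_num))
    push_cast at hmean; norm_num; linarith
  · have hc := triple_P2_cut 4 10 (Or.inr (Or.inr (Or.inr ⟨rfl, rfl⟩))) p₁ p₂ p₃ (by push_cast at hmean ⊢; linarith)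
      (hdec 5 (by norm_num))
    push_cast at hmean; norm_num; linarith

/-- **`Φ ≤ 0` on every AD3⁺ component at `(y, q, T, M) = (99/125, 99/100, 97/10, 12)` supported inside `S = {1,2,4,9,10,12}`.** [this work] -/
theorem phi_component_nonpos (ω : ℕ → ℝ) (hc : IsAD3Component (99/125) (99/100) (97/10) 12 ω)
    (hS : ∀ h, h ≠ 1 → h ≠ 2 → h ≠ 4 → h ≠ 9 → h ≠ 10 → h ≠ 12 → ω h = 0) : PHI[ω] ≤ 0 := by
  rcases hc with ⟨lo, hi, γ, hlohi, -, hγ0, hγ1, hheavy, hmean, rfl⟩ | ⟨lo, hi, γ, hlt, -, hγ0, hγ1, hlight, hmean, hdec, rfl⟩ |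
      ⟨s₁, s₂, s₃, p₁, p₂, p₃, h12, h23, -, hp₁, hp₂, hp₃, hsum, hmean, -, hdec, rfl⟩
  · exact phi_pair_nonpos lo hi γ hlohi hγ0 hγ1 hmean (Or.inl hheavy) hS
  · exact phi_pair_nonpos lo hi γ hlt.le hγ0 hγ1 hmean (Or.inr ⟨hlight, hdec⟩) hS
  · exact phi_triple_nonpos s₁ s₂ s₃ p₁ p₂ p₃ h12 h23 hp₁ hp₂ hp₃ hsum hmean hdec hS

/-! ### The witness and its product -/

/-- `P` vanishes off `S`. [this work] -/
theorem P_off (h : ℕ) (h1 : h ≠ 1) (h2 : h ≠ 2) (h4 : h ≠ 4) (h9 : h ≠ 9) (h10 : h ≠ 10) (h12 : h ≠ 12) : PW h = 0 := by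
  simp only [if_neg h1, if_neg h2, if_neg h4, if_neg h9, if_neg h10, if_neg h12]

/-- **the product of the witness components is `P`.** [this work] -/
theorem lconv_witness :
    lconv 4 8 (fun h => TR[1, 2, 4, (1/10 : ℝ), (1/5 : ℝ), (7/10 : ℝ), h]) (fun h => TP[0, 8, (4/5 : ℝ), h]) = PW := by
  funext h
  have h1M : ∀ k, 4 < k → TR[1, 2, 4, (1/10 : ℝ), (1/5 : ℝ), (7/10 : ℝ), k] = 0 := by
    intro k hk
    rw [if_neg (by omega), if_neg (by omega), if_neg (by omega)]
    ring
  rw [lconv_TP 4 8 0 8 (fun h => TR[1, 2, 4, (1/10 : ℝ), (1/5 : ℝ), (7/10 : ℝ), h]) (4/5 : ℝ) h1M (by norm_num) le_rfl h]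
  by_cases hh : h ≤ 12
  · interval_cases h <;> norm_num
  · rw [if_pos (Nat.zero_le h), if_pos (show 8 ≤ h by omega)]
    simp only [Nat.sub_zero]
    split_ifs <;> first | (exfalso; omega) | norm_num

/-- `ω₁ = TR[1,2,4; 1/10,1/5,7/10]` is an AD3⁺ component (residue triple) at `(99/125, 99/100, 33/10, 4)`. [this work] -/
theorem omega1_component :
    IsAD3Component (99/125) (99/100) (33/10) 4 (fun h => TR[1, 2, 4, (1/10 : ℝ), (1/5 : ℝ), (7/10 : ℝ), h]) :=
  Or.inr (Or.inr ⟨1, 2, 4, 1/10, 1/5, 7/10, by norm_num, by norm_num, le_rfl, by norm_num, by norm_num, by norm_num, by norm_num,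
    by push_cast; norm_num, Or.inl ⟨by push_cast; norm_num, by push_cast; norm_num⟩, omega1_dec, rfl⟩)

/-- `ω₂ = TP[0,8; 4/5]` is an AD3⁺ component (heavy pair at threshold) at `(99/125, 99/100, 32/5, 8)`. [this work] -/
theorem omega2_component : IsAD3Component (99/125) (99/100) (32/5) 8 (fun h => TP[0, 8, (4/5 : ℝ), h]) :=
  Or.inl ⟨0, 8, 4/5, by norm_num, le_rfl, by norm_num, by norm_num, by norm_num, by push_cast; norm_num, rfl⟩

/-- **the product of the witness components is not AD3⁺**: `lconv 4 8 ω₁ ω₂` is not `AD3Decomp (99/125) (99/100) (33/10 + 32/5) (4 + 8)` —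
the Farkas functional `Φ` is nonpositive on every component supported in the product's support but positive on the product.  (Stated in the
shape the product cells conclude, so that every cell quantifying over these two components is refuted by one application.) [this work] -/
theorem not_ad3Decomp_witness :
    ¬ AD3Decomp (99/125) (99/100) (33/10 + 32/5) (4 + 8)
      (lconv 4 8 (fun h => TR[1, 2, 4, (1/10 : ℝ), (1/5 : ℝ), (7/10 : ℝ), h]) (fun h => TP[0, 8, (4/5 : ℝ), h])) := by
  intro hD
  have hD' : AD3Decomp (99/125) (99/100) (97/10) 12 PW := by
    rw [lconv_witness, show (33/10 : ℝ) + 32/5 = 97/10 by norm_num] at hD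
    exact hD
  obtain ⟨κ, _, v, ω, hv0, -, hmix, hcomp⟩ := (ad3Decomp_iff _ _ _ _ _).1 hD'
  -- genuine components are nonnegative and supported inside S
  have hterm0 : ∀ h k, 0 ≤ v k * ω k h := by
    intro h k
    rcases (hv0 k).eq_or_lt with hz | hpos
    · rw [← hz, zero_mul]
    · exact mul_nonneg hpos.le ((isAD3Component_laws (hcomp k hpos)).1 h)
  have hS : ∀ k, 0 < v k → ∀ h, h ≠ 1 → h ≠ 2 → h ≠ 4 → h ≠ 9 → h ≠ 10 → h ≠ 12 → ω k h = 0 := by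
    intro k hk h h1 h2 h4 h9 h10 h12
    have hsum0 : ∑ k, v k * ω k h = 0 := by rw [← hmix h]; exact P_off h h1 h2 h4 h9 h10 h12
    have hk0 := (Finset.sum_eq_zero_iff_of_nonneg (fun k _ => hterm0 h k)).1 hsum0 k (Finset.mem_univ k)
    rcases mul_eq_zero.1 hk0 with hv | hω
    · exact absurd hv hk.ne'
    · exact hω
  -- Φ is linear, positive on the product, nonpositive on every genuine component
  have hphi : (10913/331279 : ℝ) * (∑ k, v k * ω k 1) + 5/17 * (∑ k, v k * ω k 2) + (∑ k, v k * ω k 4) - (∑ k, v k * ω k 9)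
      - 11/17 * (∑ k, v k * ω k 10) + 1/17 * (∑ k, v k * ω k 12) = ∑ k, v k * PHI[ω k] := by
    simp only [Finset.mul_sum, ← Finset.sum_add_distrib, ← Finset.sum_sub_distrib]
    exact Finset.sum_congr rfl fun k _ => by ring
  have hpos : (0 : ℝ) < (10913/331279 : ℝ) * (∑ k, v k * ω k 1) + 5/17 * (∑ k, v k * ω k 2) + (∑ k, v k * ω k 4)
      - (∑ k, v k * ω k 9) - 11/17 * (∑ k, v k * ω k 10) + 1/17 * (∑ k, v k * ω k 12) := by
    rw [← hmix 1, ← hmix 2, ← hmix 4, ← hmix 9, ← hmix 10, ← hmix 12]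
    norm_num
  have hle : ∑ k, v k * PHI[ω k] ≤ 0 := by
    refine Finset.sum_nonpos fun k _ => ?_
    rcases (hv0 k).eq_or_lt with hz | hvk
    · rw [← hz, zero_mul]
    · exact mul_nonpos_of_nonneg_of_nonpos hvk.le (phi_component_nonpos (ω k) (hcomp k hvk) (hS k hvk))
  linarith

end AD3ProdCellCex

open AD3ProdCellCex in
/-- **`LawDec.AD3ProdCell` IS FALSE**: the product of the admissible residue triple `TR[1,2,4; 1/10,1/5,7/10]` (`M₁ = 4`) and the
threshold-heavy pair `TP[0,8; 4/5]` (`M₂ = 8`) at floor `99/125`, gate `99/100` is not `AD3Decomp` at `(97/10, 12)`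
(`AD3ProdCellCex.not_ad3Decomp_witness`). [this work] -/
theorem not_ad3ProdCell : ¬ AD3ProdCell := fun H =>
  not_ad3Decomp_witness (H (99/125) (99/100) (33/10) (32/5) 4 8 _ _ (by norm_num) (by norm_num) (by norm_num) (by norm_num)
    (by norm_num) omega1_component omega2_component)

end LawDec

end Quant

end Summit.CriticalPhenomena.PercolationContinuityZ3.Theorems
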